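import Mathlib.Algebra.MvPolynomial.Eval
import Mathlib.Algebra.MvPolynomial.Degrees
import Mathlib.Algebra.Polynomial.Roots
import Mathlib.Algebra.Polynomial.BigOperators
import Mathlib.Algebra.BigOperators.Fin
import Mathlib.Topology.Algebra.Polynomial
import Mathlib.Topology.Order.IntermediateValue
import Mathlib.Topology.MetricSpace.Bounded
import Mathlib.Topology.MetricSpace.Pseudo.Pi
import Mathlib.Data.Sign.Basic
import Literature.ModelTheory.ExponentialFields.Semialgebraic
import Literature.ModelTheory.ExponentialFields.TarskiSeidenbergProofs
import Literature.Computability.Complexity.ElementaryRecursive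
import Literature.Computability.Complexity.ElementaryRealProofs
import Literature.NumberTheory.Transcendental.YoshinagaLatticeDiscrepancy
import Literature.NumberTheory.Transcendental.PeriodConjecture
import Literature.NumberTheory.Transcendental.BoundedPeriodComputable
import HarnessLib

/-!
# Volumes of bounded semialgebraic sets are elementary reals (Yoshinaga 2008, §3.3–3.6)

M. Yoshinaga, *Periods and elementary real numbers*, arXiv:0805.0349 (2008), proves his main
theorem (Thm. 18: real Kontsevich–Zagier periods are elementary real numbers — the tree's named
fact `Literature.NumberTheory.Transcendental.isElementaryReal_of_isRealPeriod`) in two steps: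

1. (Lemma 24, via Hironaka's rectilinearization, Belkale–Brosnan's description of periods and a
   semialgebraic triangulation) the real periods are generated, as an additive group, by the
   volumes of bounded (basic open) semialgebraic sets with integer coefficients;
2. (§3.3–3.6: Thm. 25/Lemma 26, Lemma 29, and Prop. 10) the volume of a bounded semialgebraic set
   is an elementary real number, and elementary reals form a field.

This file completes the tree's proof of **step 2** by the lattice-point variant begun in
`YoshinagaLattice1D.lean` and `YoshinagaLatticeDiscrepancy.lean` (which replace the
Minkowski-content estimate of Lemma 29 by an induction over coordinates for *line-tame* sets):

* **Sign cells are line-tame** (`Yoshinaga.lineTame_signCell`).  A *sign cell* is a set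
  `{x ∈ ℝ^m | (sign Fᵢ(x))ᵢ ∈ T}` cut out by prescribing the admissible simultaneous signs `T` of
  a finite family `F` of polynomials with rational coefficients; by the sign-condition normal form
  (`Literature.ModelTheory.ExponentialFields.IsSemialgebraic.exists_eq_setOf_signVec_mem`) every
  `ℚ`-semialgebraic set is one.  Restricted to an axis-parallel line each `Fᵢ` is a real
  polynomial of degree `≤ totalDegree Fᵢ` (`Yoshinaga.linePoly`), zero or with at most that many
  roots, and between the roots all signs are constant (intermediate value theorem).  This is
  where Yoshinaga (§3.3–3.4) decides membership of the cubes `C_n(k)` in `D` by sign conditions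
  via Tarski's quantifier elimination (Thm. 25); for lattice *points* no elimination is needed.
* **The lattice count is Kalmár elementary** (`Yoshinaga.elementaryRec_latticeCount_signCell`,
  the tree's form of Lemma 26 "`n ↦ vol(V_n)` is elementary"): clearing denominators,
  `c · N^d · Fᵢ((K - rN)/N) = P⁺ᵢ(N, K) - P⁻ᵢ(N, K)` with `P^±ᵢ ∈ ℕ[N, K]`
  (`Yoshinaga.exists_nat_rep`), so each sign is an order comparison of two elementary functions
  of the code `⟨N, K⟩` (Example 7 (4)), and the count is a bounded sum (Def. 6) over the codes
  `c < (2rN)^m` of the multi-indices `K` (base-`2rN` digits) of a sum of products of such tests.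
* **Assembly** (`Yoshinaga.isElementaryReal_volume_of_isSemialgebraic_of_isBounded` = the
  conclusion "`vol(D) ∈ ℝ_elem`" of §3.6; Tent–Ziegler 2010, Cor. 6.3): enclose `D` in a box
  `[-r, r)^m`, combine the discrepancy bound `m s (2r)^m / N` with the elementary count through
  `IsElementaryReal.of_nat_approx`.
* **Reduction of Thm. 18 to Lemma 24** (`isElementaryReal_of_isRealPeriod_of_lemma24`, additive
  reading of "generated"; `…_of_lemma24'`, ring reading): Yoshinaga's theorem holds as soon as
  every real period lies in the additive subgroup (resp. subring) of `ℝ` generated by the volumes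
  of bounded `ℚ`-semialgebraic sets.  Lemma 24 itself (resolution of singularities) is NOT
  formalised here; it is the only missing input for `isElementaryReal_of_isRealPeriod`.

* **The other two forms of the missing input.** `SemialgebraicVolumeComputable.lean` and
  `BoundedPeriodComputable.lean` reduce the *computability* facts of `PeriodConjecture.lean` to
  (i) the *bounded reduction* "every real period is `vol(K₁) - vol(K₂)` with `K₁, K₂` bounded
  `ℚ`-semialgebraic" (Viu-Sos 2021, Cor. 2.3) and (ii) the existence of a representation with
  bounded domain and bounded integrand (Lemma 24 (i)).  The same hypotheses give *elementarity*:
  `isElementaryReal_of_isRealPeriod_of_boundedReduction`,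
  `KZ.IntegralRep.isElementaryReal_value_of_bounded`,
  `isElementaryReal_of_isRealPeriod_of_boundedRepresentation`.  So any one of these forms of
  Lemma 24 closes both Yoshinaga facts.

Relation to `SemialgebraicVolumeComputable.lean` (volumes of bounded `ℚ`-semialgebraic sets are
*computable*): there the modulus of convergence is found by unbounded search from a two-sided
squeeze (no rate; computability only).  Kalmár elementarity needs an explicit elementary rate,
which is what the discrepancy bound of `YoshinagaLatticeDiscrepancy.lean` supplies; by
`IsElementaryReal.isComputableReal_holds` the present result implies that one.

Everything in this file is proved; the definitions (`signVec`, `signCell`, `linePoly`,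
`lineRoots`, `signTest`, `digits`, `cellIndicator`) are auxiliary and carry no named facts.

## References

* M. Yoshinaga, *Periods and elementary real numbers*, arXiv:0805.0349 (2008), §2.2 (Def. 6,
  Example 7), §3.1 (Thm. 18), §3.2 (Lemma 24), §3.3 (Thm. 25), §3.4 (Lemma 26), §3.6 (Lemma 29),
  Prop. 10.
* K. Tent, M. Ziegler, *Computable functions of reals*, Münster J. Math. 3 (2010), Cor. 6.3
  (volumes of bounded semialgebraic sets are lower elementary), Cor. 6.4.
* S. Basu, R. Pollack, M.-F. Roy, *Algorithms in Real Algebraic Geometry* (2006), Def. 2.25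
  (sign conditions).
-/

noncomputable section

open scoped Classical
open MeasureTheory Set Finset MvPolynomial Metric
open Literature.Computability.Complexity Literature.ModelTheory.ExponentialFields

namespace Literature.NumberTheory.Transcendental

namespace Yoshinaga

variable {ι : Type*} {m : ℕ}

/-! ## Part I. Sign cells are line-tame -/

/-! ### Sign cells -/

/-- The vector of signs of the polynomials `F i` at the point `x`.
[cite: BasuPollackRoy2006, Def. 2.25] -/
def signVec (F : ι → MvPolynomial (Fin m) ℚ) (x : Fin m → ℝ) : ι → SignType :=
  fun i => SignType.sign (aeval x (F i))

/-- The *sign cell* of the family `F` and the set `T` of admissible sign conditions: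
`{x | (sign Fᵢ(x))ᵢ ∈ T}`. [cite: BasuPollackRoy2006, Def. 2.25] -/
def signCell (F : ι → MvPolynomial (Fin m) ℚ) (T : Set (ι → SignType)) : Set (Fin m → ℝ) :=
  {x | signVec F x ∈ T}

/-- Membership in a sign cell. [folklore] -/
theorem mem_signCell {F : ι → MvPolynomial (Fin m) ℚ} {T : Set (ι → SignType)} {x : Fin m → ℝ} :
    x ∈ signCell F T ↔ signVec F x ∈ T := Iff.rfl

/-! ### Restriction of a polynomial to an axis-parallel line -/

/-- The restriction of `q ∈ ℚ[X₁, …, X_m]` to the line through `x` in the `k`-th coordinate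
direction, as a real polynomial in the free coordinate. [folklore] -/
def linePoly (q : MvPolynomial (Fin m) ℚ) (k : Fin m) (x : Fin m → ℝ) : Polynomial ℝ :=
  aeval (fun j => if j = k then Polynomial.X else Polynomial.C (x j)) q

/-- Evaluating the restricted polynomial at `t` is evaluating `q` at the point of the line with
free coordinate `t`. [folklore] -/
theorem eval_linePoly (q : MvPolynomial (Fin m) ℚ) (k : Fin m) (x : Fin m → ℝ) (t : ℝ) :
    (linePoly q k x).eval t = aeval (Function.update x k t) q := by
  induction q using MvPolynomial.induction_on with
  | C a =>
    simp [linePoly, Polynomial.eval_C]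
  | add p q hp hq =>
    simp only [linePoly, map_add, Polynomial.eval_add] at hp hq ⊢
    rw [hp, hq]
  | mul_X p j hp =>
    simp only [linePoly, map_mul, aeval_X, Polynomial.eval_mul] at hp ⊢
    rw [hp]
    congr 1
    by_cases hj : j = k
    · subst hj; simp
    · simp [hj]

/-- The restricted polynomial has degree at most the total degree of `q`. [folklore] -/
theorem natDegree_linePoly_le (q : MvPolynomial (Fin m) ℚ) (k : Fin m) (x : Fin m → ℝ) :
    (linePoly q k x).natDegree ≤ q.totalDegree := by
  set g : Fin m → Polynomial ℝ := fun j => if j = k then Polynomial.X else Polynomial.C (x j) with hg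
  have hg1 : ∀ j, (g j).natDegree ≤ 1 := by
    intro j
    by_cases hj : j = k
    · simp [hg, hj]
    · simp [hg, hj]
  conv_lhs => rw [linePoly, q.as_sum, map_sum]
  refine Polynomial.natDegree_sum_le_of_forall_le _ _ fun d hd => ?_
  rw [aeval_monomial, Polynomial.algebraMap_apply]
  refine (Polynomial.natDegree_C_mul_le _ _).trans ?_
  rw [Finsupp.prod]
  refine (Polynomial.natDegree_prod_le _ _).trans ?_
  refine le_trans ?_ (le_totalDegree hd)
  rw [Finsupp.sum]
  refine Finset.sum_le_sum fun j _ => ?_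
  refine Polynomial.natDegree_pow_le.trans ?_
  have h1 : (g j).natDegree ≤ 1 := hg1 j
  calc d j * (g j).natDegree ≤ d j * 1 := Nat.mul_le_mul_left _ h1
    _ = d j := mul_one _

/-- The exceptional set of a line: the real roots of the non-zero restrictions of the `F i`
(for the zero polynomial Mathlib's `roots` is empty). [folklore] -/
def lineRoots [Fintype ι] (F : ι → MvPolynomial (Fin m) ℚ) (k : Fin m) (x : Fin m → ℝ) : Finset ℝ :=
  Finset.univ.biUnion fun i => (linePoly (F i) k x).roots.toFinset

/-- The exceptional set has at most `Σᵢ totalDegree Fᵢ` points. [folklore] -/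
theorem card_lineRoots_le [Fintype ι] (F : ι → MvPolynomial (Fin m) ℚ) (k : Fin m) (x : Fin m → ℝ) :
    (lineRoots F k x).card ≤ ∑ i, (F i).totalDegree := by
  refine Finset.card_biUnion_le.trans (Finset.sum_le_sum fun i _ => ?_)
  exact (Multiset.toFinset_card_le _).trans
    ((Polynomial.card_roots' _).trans (natDegree_linePoly_le _ _ _))

/-- Between two points of a line not separated by (nor equal to) a root of a non-zero restricted
polynomial, that polynomial keeps its sign (intermediate value theorem). [folklore] -/
theorem sign_eval_eq_of_forall_not_mem {P : Polynomial ℝ} {t₁ t₂ : ℝ} (ht : t₁ ≤ t₂)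
    (hZ : ∀ z ∈ P.roots.toFinset, z ∉ Icc t₁ t₂) :
    SignType.sign (P.eval t₁) = SignType.sign (P.eval t₂) := by
  by_cases hP : P = 0
  · simp [hP]
  have key : ∀ t ∈ Icc t₁ t₂, P.eval t ≠ 0 := by
    intro t htI h0
    refine hZ t ?_ htI
    rw [Multiset.mem_toFinset, Polynomial.mem_roots hP]
    exact h0
  have h1 := key t₁ ⟨le_rfl, ht⟩
  have h2 := key t₂ ⟨ht, le_rfl⟩
  have hcont : ContinuousOn (fun t => P.eval t) (Icc t₁ t₂) := P.continuous.continuousOn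
  rcases lt_or_gt_of_ne h1 with h1 | h1 <;> rcases lt_or_gt_of_ne h2 with h2 | h2
  · rw [sign_neg h1, sign_neg h2]
  · exfalso
    obtain ⟨t, htI, h0⟩ := intermediate_value_Icc ht hcont ⟨h1.le, h2.le⟩
    exact key t htI h0
  · exfalso
    obtain ⟨t, htI, h0⟩ := intermediate_value_Icc' ht hcont ⟨h2.le, h1.le⟩
    exact key t htI h0
  · rw [sign_pos h1, sign_pos h2]

/-- Along a segment of an axis-parallel line avoiding the exceptional set, the sign vector of `F`
is constant. [folklore] -/
theorem signVec_update_eq [Fintype ι] (F : ι → MvPolynomial (Fin m) ℚ) (k : Fin m) (x : Fin m → ℝ)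
    {t₁ t₂ : ℝ} (ht : t₁ ≤ t₂) (hZ : ∀ z ∈ lineRoots F k x, z ∉ Icc t₁ t₂) :
    signVec F (Function.update x k t₁) = signVec F (Function.update x k t₂) := by
  funext i
  simp only [signVec, ← eval_linePoly]
  refine sign_eval_eq_of_forall_not_mem ht fun z hz => hZ z ?_
  exact Finset.mem_biUnion.2 ⟨i, Finset.mem_univ i, hz⟩

/-- **Sign cells are line-tame** with bound `Σᵢ totalDegree Fᵢ`: on every axis-parallel line,
membership in `{x | (sign Fᵢ(x))ᵢ ∈ T}` is constant along segments avoiding the (at most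
`Σᵢ totalDegree Fᵢ`) real roots of the non-zero restricted polynomials. (Yoshinaga 2008, §3.4,
decides membership of the cubes of the Riemann sum by the signs of the defining polynomials.)
[cite: Yoshinaga2008, Lemma 26] -/
theorem lineTame_signCell [Fintype ι] (F : ι → MvPolynomial (Fin m) ℚ) (T : Set (ι → SignType)) :
    LineTame (∑ i, (F i).totalDegree) (signCell F T) := by
  intro k x
  refine ⟨lineRoots F k x, card_lineRoots_le F k x, fun t₁ t₂ ht hZ => ?_⟩
  rw [mem_signCell, mem_signCell, signVec_update_eq F k x ht hZ]

/-! ## Part II. The lattice count of a sign cell is Kalmár elementary -/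

/-! ### Elementary indicator arithmetic: finite sums and products, sign tests -/

/-- Finite sums of elementary functions are elementary. [cite: Yoshinaga2008, Definition 6] -/
theorem elementaryRec_finset_sum {α : Type*} (S : Finset α) {f : α → ℕ → ℕ}
    (h : ∀ a ∈ S, ElementaryRec (f a)) : ElementaryRec fun n => ∑ a ∈ S, f a n := by
  induction S using Finset.induction_on with
  | empty => exact (ElementaryRec.const 0).of_eq fun n => by simp
  | insert a S ha ih =>
    exact ((h a (Finset.mem_insert_self a S)).add'
      (ih fun b hb => h b (Finset.mem_insert_of_mem hb))).of_eq fun n => by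
        rw [Finset.sum_insert ha]

/-- Finite products of elementary functions are elementary. [cite: Yoshinaga2008, Definition 6] -/
theorem elementaryRec_finset_prod {α : Type*} (S : Finset α) {f : α → ℕ → ℕ}
    (h : ∀ a ∈ S, ElementaryRec (f a)) : ElementaryRec fun n => ∏ a ∈ S, f a n := by
  induction S using Finset.induction_on with
  | empty => exact (ElementaryRec.const 1).of_eq fun n => by simp
  | insert a S ha ih =>
    exact ((h a (Finset.mem_insert_self a S)).mul'
      (ih fun b hb => h b (Finset.mem_insert_of_mem hb))).of_eq fun n => by
        rw [Finset.prod_insert ha]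

/-- The `{0,1}`-valued test "`sign (x - y) = σ`" on natural numbers `x, y`, written with the
order predicates (Yoshinaga 2008, Example 7 (4)). [cite: Yoshinaga2008, Example 7 (4)] -/
def signTest : SignType → ℕ → ℕ → ℕ
  | SignType.zero, x, y => if x = y then 1 else 0
  | SignType.neg, x, y => if x < y then 1 else 0
  | SignType.pos, x, y => if y < x then 1 else 0

/-- `signTest σ x y` is the indicator of `sign (x - y) = σ` (difference taken in `ℤ`). [folklore] -/
theorem signTest_eq_ite (σ : SignType) (x y : ℕ) :
    signTest σ x y = if SignType.sign ((x : ℤ) - y) = σ then 1 else 0 := by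
  cases σ with
  | zero =>
    rw [signTest]
    refine if_congr ?_ rfl rfl
    rw [SignType.zero_eq_zero, sign_eq_zero_iff, sub_eq_zero, Nat.cast_inj]
  | neg =>
    rw [signTest]
    refine if_congr ?_ rfl rfl
    rw [SignType.neg_eq_neg_one, sign_eq_neg_one_iff, sub_neg, Nat.cast_lt]
  | pos =>
    rw [signTest]
    refine if_congr ?_ rfl rfl
    rw [SignType.pos_eq_one, sign_eq_one_iff, sub_pos, Nat.cast_lt]

/-- The sign test of two elementary functions is elementary (the order predicates are
elementary, Yoshinaga 2008, Example 7 (4)). [cite: Yoshinaga2008, Example 7 (4)] -/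
theorem elementaryRec_signTest {a b : ℕ → ℕ} (ha : ElementaryRec a) (hb : ElementaryRec b)
    (σ : SignType) : ElementaryRec fun n => signTest σ (a n) (b n) := by
  cases σ with
  | zero => exact (ElementaryRec.ite_eq ha hb).of_eq fun n => by rw [signTest]
  | neg => exact (ElementaryRec.ite_lt ha hb).of_eq fun n => by rw [signTest]
  | pos => exact (ElementaryRec.ite_lt hb ha).of_eq fun n => by rw [signTest]

/-- A product of indicators `[f i = t i]` over a finite type is the indicator `[f = t]`.
[folklore] -/
theorem prod_signTest_eq_ite [Fintype ι] (t : ι → SignType) (x y : ι → ℕ) :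
    ∏ i, signTest (t i) (x i) (y i) =
      if (fun i => SignType.sign ((x i : ℤ) - y i)) = t then 1 else 0 := by
  simp only [signTest_eq_ite]
  split_ifs with h
  · refine Finset.prod_eq_one fun i _ => ?_
    rw [if_pos (congrFun h i)]
  · obtain ⟨i, hi⟩ : ∃ i, SignType.sign ((x i : ℤ) - y i) ≠ t i := by
      by_contra hcon
      simp only [not_exists, not_not] at hcon
      exact h (funext hcon)
    exact Finset.prod_eq_zero (Finset.mem_univ i) (if_neg hi)

/-- Summing the indicators `[v = t]` over the admissible sign conditions `t ∈ T` gives the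
indicator `[v ∈ T]`. [folklore] -/
theorem sum_prod_signTest_eq_ite [Fintype ι] (T : Set (ι → SignType)) (x y : ι → ℕ) :
    ∑ t ∈ T.toFinset, ∏ i, signTest (t i) (x i) (y i) =
      if (fun i => SignType.sign ((x i : ℤ) - y i)) ∈ T then 1 else 0 := by
  simp only [prod_signTest_eq_ite]
  rw [Finset.sum_ite_eq]
  exact if_congr Set.mem_toFinset rfl rfl

/-- Evaluation of a polynomial with natural-number coefficients at elementary functions is
elementary (closure under `+`, `·` and constants). [cite: Yoshinaga2008, Definition 6] -/
theorem elementaryRec_eval {k : ℕ} {v : Fin k → ℕ → ℕ} (hv : ∀ j, ElementaryRec (v j))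
    (P : MvPolynomial (Fin k) ℕ) : ElementaryRec fun n => MvPolynomial.eval (fun j => v j n) P := by
  induction P using MvPolynomial.induction_on with
  | C a => exact (ElementaryRec.const a).of_eq fun n => by simp
  | add p q hp hq => exact (hp.add' hq).of_eq fun n => by simp
  | mul_X p j hp => exact (hp.mul' (hv j)).of_eq fun n => by simp

/-! ### Clearing denominators at lattice points -/

/-- **Integer form of a rational polynomial at the lattice points.** For `q ∈ ℚ[X₁, …, X_m]` and
`r ∈ ℕ` there are `d`, `c > 0` and `P⁺, P⁻ ∈ ℕ[N, K₁, …, K_m]` with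
`c · N^d · q((Kᵢ/N - r)ᵢ) = P⁺(N, K) - P⁻(N, K)` for all `K ∈ ℕ^m`, `N ≥ 1` (so the sign of `q`
at a lattice point is the comparison of two natural numbers; Yoshinaga 2008, §3.4, eq. before
Lemma 26: the sign conditions `p(k_i r/n, (k_i+1) r/n, a_{kJ}) > 0` "can be decided elementarily").
Induction on `q`. [cite: Yoshinaga2008, Lemma 26] -/
theorem exists_nat_rep (r : ℕ) (q : MvPolynomial (Fin m) ℚ) :
    ∃ (d c : ℕ) (Pp Pm : MvPolynomial (Fin (m + 1)) ℕ), 0 < c ∧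
      ∀ (K : Fin m → ℕ) (N : ℕ), 0 < N →
        (c : ℝ) * (N : ℝ) ^ d * aeval (latticePoint r N K) q =
          (MvPolynomial.eval (Fin.cons N K) Pp : ℝ) - (MvPolynomial.eval (Fin.cons N K) Pm : ℝ) := by
  induction q using MvPolynomial.induction_on with
  | C a =>
    refine ⟨0, a.den, C a.num.toNat, C (-a.num).toNat, a.den_pos, fun K N _ => ?_⟩
    have hnum : (((a.num.toNat : ℕ) : ℝ) - ((-a.num).toNat : ℕ)) = (a.num : ℝ) := by
      exact_mod_cast Int.toNat_sub_toNat_neg a.num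
    have hden : (a.den : ℝ) * (a : ℝ) = a.num := by
      have h := Rat.mul_den_eq_num a
      rw [mul_comm]
      exact_mod_cast h
    simp only [pow_zero, mul_one, algHom_C, eval_C, eq_ratCast]
    rw [hnum, hden]
  | add p q hp hq =>
    obtain ⟨dp, cp, Pp, Pm, hcp, hp⟩ := hp
    obtain ⟨dq, cq, Qp, Qm, hcq, hq⟩ := hq
    refine ⟨dp + dq, cp * cq, C cq * X 0 ^ dq * Pp + C cp * X 0 ^ dp * Qp,
      C cq * X 0 ^ dq * Pm + C cp * X 0 ^ dp * Qm, Nat.mul_pos hcp hcq, fun K N hN => ?_⟩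
    have h1 := hp K N hN
    have h2 := hq K N hN
    simp only [map_add, map_mul, eval_C, map_pow, eval_X, Fin.cons_zero]
    push_cast
    calc ((cp : ℝ) * cq) * (N : ℝ) ^ (dp + dq) *
          (aeval (latticePoint r N K) p + aeval (latticePoint r N K) q)
        = (cq : ℝ) * (N : ℝ) ^ dq * ((cp : ℝ) * (N : ℝ) ^ dp * aeval (latticePoint r N K) p) +
          (cp : ℝ) * (N : ℝ) ^ dp * ((cq : ℝ) * (N : ℝ) ^ dq * aeval (latticePoint r N K) q) := by
          ring
      _ = _ := by rw [h1, h2]; ring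
  | mul_X p j hp =>
    obtain ⟨d, c, Pp, Pm, hc, hp⟩ := hp
    refine ⟨d + 1, c, Pp * X j.succ + Pm * (C r * X 0), Pm * X j.succ + Pp * (C r * X 0), hc,
      fun K N hN => ?_⟩
    have h1 := hp K N hN
    have hN' : (N : ℝ) ≠ 0 := by exact_mod_cast hN.ne'
    have hpt : latticePoint r N K j = (K j : ℝ) / N - r := rfl
    simp only [map_add, map_mul, aeval_X, eval_X, eval_C, Fin.cons_succ, Fin.cons_zero, hpt]
    push_cast
    calc (c : ℝ) * (N : ℝ) ^ (d + 1) * (aeval (latticePoint r N K) p * ((K j : ℝ) / N - r))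
        = ((c : ℝ) * (N : ℝ) ^ d * aeval (latticePoint r N K) p) * (N * ((K j : ℝ) / N - r)) := by
          ring
      _ = ((MvPolynomial.eval (Fin.cons N K) Pp : ℝ) - (MvPolynomial.eval (Fin.cons N K) Pm : ℝ)) *
          ((K j : ℝ) - r * N) := by
          rw [h1]
          congr 1
          field_simp
      _ = _ := by ring

/-- Casting from `ℤ` to `ℝ` preserves signs. [folklore] -/
theorem sign_intCast_real (z : ℤ) : SignType.sign (z : ℝ) = SignType.sign z := by
  rcases lt_trichotomy z 0 with h | h | h
  · rw [sign_neg h, sign_neg (by exact_mod_cast h)]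
  · subst h; simp
  · rw [sign_pos h, sign_pos (by exact_mod_cast h)]

/-- With `c N^d q = P⁺ - P⁻` as in `exists_nat_rep`, the sign of `q` at a lattice point is the sign
of the integer `P⁺(N, K) - P⁻(N, K)`. [cite: Yoshinaga2008, Lemma 26] -/
theorem sign_aeval_latticePoint_eq {r d c : ℕ} {q : MvPolynomial (Fin m) ℚ}
    {Pp Pm : MvPolynomial (Fin (m + 1)) ℕ} (hc : 0 < c)
    (h : ∀ (K : Fin m → ℕ) (N : ℕ), 0 < N →
      (c : ℝ) * (N : ℝ) ^ d * aeval (latticePoint r N K) q =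
        (MvPolynomial.eval (Fin.cons N K) Pp : ℝ) - (MvPolynomial.eval (Fin.cons N K) Pm : ℝ))
    (K : Fin m → ℕ) {N : ℕ} (hN : 0 < N) :
    SignType.sign (aeval (latticePoint r N K) q) =
      SignType.sign ((MvPolynomial.eval (Fin.cons N K) Pp : ℤ) - (MvPolynomial.eval (Fin.cons N K) Pm : ℤ)) := by
  have hpos : (0 : ℝ) < (c : ℝ) * (N : ℝ) ^ d := by positivity
  rw [← sign_intCast_real]
  push_cast
  rw [← h K N hN, sign_mul, sign_mul, sign_pos (by exact_mod_cast hc : (0 : ℝ) < c),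
    sign_pos (by positivity : (0 : ℝ) < (N : ℝ) ^ d), one_mul, one_mul]

/-! ### The lattice count as a count over codes of multi-indices -/

/-- Base-`B` digits of a code `c`: the multi-index `(c / B^i % B)_i`. [folklore] -/
def digits (B c : ℕ) : Fin m → ℕ := fun i => c / B ^ (i : ℕ) % B

/-- The lattice count is the number of codes `c < (2rN)^m` whose multi-index of digits gives a
lattice point in `A` (reindexing along `finFunctionFinEquiv`). [folklore] -/
theorem latticeCount_eq_card_filter_range (r N : ℕ) (A : Set (Fin m → ℝ)) :
    latticeCount r N A = ((Finset.range ((2 * r * N) ^ m)).filter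
      fun c => latticePoint r N (digits (2 * r * N) c) ∈ A).card := by
  set B := 2 * r * N with hB
  unfold latticeCount
  rw [Finset.card_filter, Finset.card_filter,
    ← Fin.sum_univ_eq_sum_range (fun c => if latticePoint r N (digits B c) ∈ A then 1 else 0) (B ^ m),
    ← (finFunctionFinEquiv (m := B) (n := m)).symm.sum_comp]
  refine Finset.sum_congr rfl fun c _ => if_congr ?_ rfl rfl
  have hK : (fun i => ((finFunctionFinEquiv.symm c : Fin m → Fin B) i : ℕ)) = digits B (c : ℕ) := by
    funext i
    simp [digits, finFunctionFinEquiv_symm_apply_val]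
  rw [hK]

/-! ### The lattice count of a sign cell is elementary -/

/-- The coordinates `N = n.unpair.1` and the digits of `c = n.unpair.2` in base `2 r N` are
elementary functions of the code `n = ⟨N, c⟩`. [cite: Yoshinaga2008, Example 7 (5)] -/
theorem elementaryRec_cons_digits (r : ℕ) (j : Fin (m + 1)) :
    ElementaryRec fun n : ℕ =>
      (Fin.cons n.unpair.1 (digits (2 * r * n.unpair.1) n.unpair.2) : Fin (m + 1) → ℕ) j := by
  refine Fin.cases ?_ (fun i => ?_) j
  · exact ElementaryRec.left.of_eq fun n => by simp
  · refine (ElementaryRec.digit ElementaryRec.right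
      (ElementaryRec.mul' (ElementaryRec.const (2 * r)) ElementaryRec.left) i).of_eq fun n => ?_
    simp [digits]

/-- The indicator, as an arithmetic expression in sign tests, of "the digits `K` of `cd` in base
`2rN` satisfy one of the sign conditions `t ∈ T` in the form `sign (P⁺ᵢ(N, K) - P⁻ᵢ(N, K)) = tᵢ`
for all `i`", as a function of the code `n = ⟨N, cd⟩`. [folklore] -/
def cellIndicator [Fintype ι] (Pp Pm : ι → MvPolynomial (Fin (m + 1)) ℕ) (T : Set (ι → SignType))
    (r N cd : ℕ) : ℕ :=
  ∑ t ∈ T.toFinset, ∏ i, signTest (t i)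
    (MvPolynomial.eval (fun j => (Fin.cons N (digits (2 * r * N) cd) : Fin (m + 1) → ℕ) j) (Pp i))
    (MvPolynomial.eval (fun j => (Fin.cons N (digits (2 * r * N) cd) : Fin (m + 1) → ℕ) j) (Pm i))

/-- The cell indicator is an elementary function of the code `⟨N, cd⟩` (finite sums and products
of sign tests of polynomial expressions in `N` and the digits of `cd`).
[cite: Yoshinaga2008, Lemma 26] -/
theorem elementaryRec_cellIndicator [Fintype ι] (Pp Pm : ι → MvPolynomial (Fin (m + 1)) ℕ)
    (T : Set (ι → SignType)) (r : ℕ) :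
    ElementaryRec (Nat.unpaired (cellIndicator Pp Pm T r)) := by
  have h : ElementaryRec fun n : ℕ => cellIndicator Pp Pm T r n.unpair.1 n.unpair.2 := by
    unfold cellIndicator
    refine elementaryRec_finset_sum _ fun t _ => ?_
    refine elementaryRec_finset_prod _ fun i _ => ?_
    exact elementaryRec_signTest (elementaryRec_eval (elementaryRec_cons_digits (m := m) r) (Pp i))
      (elementaryRec_eval (elementaryRec_cons_digits (m := m) r) (Pm i)) (t i)
  exact h.of_eq fun n => rfl

/-- The value of the cell indicator: the indicator of the sign condition. [folklore] -/
theorem cellIndicator_eq_ite [Fintype ι] (Pp Pm : ι → MvPolynomial (Fin (m + 1)) ℕ)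
    (T : Set (ι → SignType)) (r N cd : ℕ) :
    cellIndicator Pp Pm T r N cd =
      if (fun i => SignType.sign
        ((MvPolynomial.eval (fun j => (Fin.cons N (digits (2 * r * N) cd) : Fin (m + 1) → ℕ) j)
            (Pp i) : ℤ) -
          (MvPolynomial.eval (fun j => (Fin.cons N (digits (2 * r * N) cd) : Fin (m + 1) → ℕ) j)
            (Pm i) : ℤ))) ∈ T then 1 else 0 := by
  unfold cellIndicator
  exact sum_prod_signTest_eq_ite T _ _

/-- The elementary core of the lattice count: the sum of the cell indicators over the codes
`cd < (2rN)^m` is an elementary function of `N` (a bounded sum, Yoshinaga 2008, Def. 6 (3)).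
[cite: Yoshinaga2008, Lemma 26] -/
theorem elementaryRec_sum_cellIndicator [Fintype ι] (Pp Pm : ι → MvPolynomial (Fin (m + 1)) ℕ)
    (T : Set (ι → SignType)) (r : ℕ) :
    ElementaryRec fun N => ∑ cd ∈ Finset.range ((2 * r * N) ^ m), cellIndicator Pp Pm T r N cd :=
  ElementaryRec.sum_range (elementaryRec_cellIndicator Pp Pm T r)
    (ElementaryRec.pow' (ElementaryRec.mul' (ElementaryRec.const (2 * r)) ElementaryRec.id')
      (ElementaryRec.const m))

/-- **The lattice count of a sign cell is Kalmár elementary in the mesh parameter `N`**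
(the tree's form of Yoshinaga 2008, Lemma 26: "the function `n ↦ vol(V_n)` is elementary").
For `N ≥ 1` membership of the lattice point with digits `K` in the cell is the Boolean
combination, over the finitely many admissible sign conditions `t ∈ T` and the indices `i`, of
the comparisons `sign (P⁺ᵢ(N, K) - P⁻ᵢ(N, K)) = tᵢ` (`exists_nat_rep`,
`sign_aeval_latticePoint_eq`), whose indicator is an elementary function of the code `⟨N, cd⟩`
(`cellIndicator`); the count is its bounded sum, and the value at `N = 0` is patched by
definition by cases. [cite: Yoshinaga2008, Lemma 26] -/
theorem elementaryRec_latticeCount_signCell [Fintype ι] (F : ι → MvPolynomial (Fin m) ℚ)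
    (T : Set (ι → SignType)) (r : ℕ) :
    ElementaryRec fun N => latticeCount r N (signCell F T) := by
  choose d c Pp Pm hc hrep using fun i => exists_nat_rep (m := m) r (F i)
  have hcount := elementaryRec_sum_cellIndicator Pp Pm T r
  -- for `N ≥ 1` the cell indicator is the indicator of membership in the sign cell
  have hind : ∀ N, 0 < N → ∀ cd, cellIndicator Pp Pm T r N cd =
      if latticePoint r N (digits (2 * r * N) cd) ∈ signCell F T then 1 else 0 := by
    intro N hN cd
    rw [cellIndicator_eq_ite]
    refine if_congr ?_ rfl rfl
    rw [mem_signCell]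
    have hsv : (fun i => SignType.sign
        ((MvPolynomial.eval (fun j => (Fin.cons N (digits (2 * r * N) cd) : Fin (m + 1) → ℕ) j)
            (Pp i) : ℤ) -
          (MvPolynomial.eval (fun j => (Fin.cons N (digits (2 * r * N) cd) : Fin (m + 1) → ℕ) j)
            (Pm i) : ℤ))) = signVec F (latticePoint r N (digits (2 * r * N) cd)) :=
      funext fun i => (sign_aeval_latticePoint_eq (hc i) (hrep i) _ hN).symm
    rw [hsv]
  -- patch the value at `N = 0`
  refine (ElementaryRec.ite_val (p := fun N => N = 0) (ElementaryRec.ite_eq ElementaryRec.id'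
    (ElementaryRec.const 0)) (ElementaryRec.const (latticeCount r 0 (signCell F T))) hcount).of_eq
    fun N => ?_
  by_cases hN : N = 0
  · subst hN; simp
  · rw [if_neg hN, latticeCount_eq_card_filter_range, Finset.card_filter]
    exact Finset.sum_congr rfl fun cd _ => hind N (Nat.pos_of_ne_zero hN) cd

/-! ## Part III. Assembly -/

/-- A bounded subset of `ℝ^m` lies in a box `[-r, r)^m` with `r ≥ 1` a natural number. [folklore] -/
theorem exists_subset_box_of_isBounded {D : Set (Fin m → ℝ)} (hD : Bornology.IsBounded D) :
    ∃ r : ℕ, 1 ≤ r ∧ D ⊆ box m r := by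
  obtain ⟨R, hR⟩ := (Metric.isBounded_iff_subset_closedBall (0 : Fin m → ℝ)).1 hD
  refine ⟨⌈max R 0⌉₊ + 1, Nat.le_add_left 1 _, fun x hx => ?_⟩
  have hx' : dist x 0 ≤ max R 0 := (Metric.mem_closedBall.1 (hR hx)).trans (le_max_left _ _)
  rw [dist_pi_le_iff (le_max_right _ _)] at hx'
  have hR' : max R 0 < (⌈max R 0⌉₊ + 1 : ℕ) := by
    push_cast
    exact lt_of_le_of_lt (Nat.le_ceil _) (lt_add_one _)
  rw [mem_box]
  intro i
  have hi : |x i| ≤ max R 0 := by simpa [Real.dist_0_eq_abs] using hx' i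
  rw [abs_le] at hi
  constructor <;> linarith [hi.1, hi.2]

/-- **Volumes of bounded sign cells are elementary reals.** For a sign cell
`A = {x | (sign Fᵢ(x))ᵢ ∈ T}` contained in the box `[-r, r)^m` (`r ≥ 1`), the number `vol(A)` is
an elementary real: it is approximated by the elementary fractions `latticeCount r N A / N^m`
to within `m s (2r)^m / N` (`abs_volumeReal_sub_latticeCount_div_le` with `lineTame_signCell`,
`elementaryRec_latticeCount_signCell`, `IsElementaryReal.of_nat_approx`). This is the conclusion
"`vol(D) ∈ ℝ_elem`" of Yoshinaga 2008, §3.6. [cite: Yoshinaga2008, Lemma 29] -/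
theorem isElementaryReal_volumeReal_signCell {ι : Type*} [Fintype ι]
    (F : ι → MvPolynomial (Fin m) ℚ) (T : Set (ι → SignType)) {r : ℕ} (hr : 1 ≤ r)
    (hA : MeasurableSet (signCell F T)) (hbox : signCell F T ⊆ box m r) :
    IsElementaryReal (volume.real (signCell F T)) := by
  set s : ℕ := ∑ i, (F i).totalDegree with hs
  refine IsElementaryReal.of_nat_approx (fun N => latticeCount r N (signCell F T)) (fun N => N ^ m)
    (m * s * (2 * r) ^ m) (elementaryRec_latticeCount_signCell F T r)
    (ElementaryRec.pow' ElementaryRec.id' (ElementaryRec.const m))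
    (fun N hN => Nat.one_le_pow _ _ hN) fun N hN => ?_
  have h := abs_volumeReal_sub_latticeCount_div_le (s := s) hN hr m (signCell F T) hA hbox
    (lineTame_signCell F T)
  push_cast
  exact h

/-- **Volumes of bounded `ℚ`-semialgebraic sets are elementary real numbers** (Yoshinaga 2008,
§3.4–3.6: Lemma 26 + Lemma 29, "this completes the proof that `vol(D)` is an elementary real
number"; Tent–Ziegler 2010, Cor. 6.3, even lower elementary).  Proof: write `D` in sign-condition
normal form (`IsSemialgebraic.exists_eq_setOf_signVec_mem`), enclose it in a box
(`exists_subset_box_of_isBounded`) and apply `isElementaryReal_volumeReal_signCell`.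
[cite: Yoshinaga2008, Lemma 29] -/
theorem isElementaryReal_volume_of_isSemialgebraic_of_isBounded {D : Set (Fin m → ℝ)}
    (hD : IsSemialgebraic ℚ D) (hb : Bornology.IsBounded D) :
    IsElementaryReal (volume D).toReal := by
  obtain ⟨Q, T, hDQ⟩ := hD.exists_eq_setOf_signVec_mem
  obtain ⟨r, hr, hbox⟩ := exists_subset_box_of_isBounded hb
  have hmeas : MeasurableSet D := IsSemialgebraic.measurableSet_holds hD
  have hcell : signCell (fun q : Q => (q : MvPolynomial (Fin m) ℚ)) T = D := by
    rw [hDQ]; rfl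
  rw [← measureReal_def, ← hcell]
  rw [← hcell] at hmeas hbox
  exact isElementaryReal_volumeReal_signCell _ T hr hmeas hbox

end Yoshinaga


/-! ### Yoshinaga's theorem reduced to his Lemma 24 -/

/-- **Yoshinaga's theorem from his Lemma 24.** If every real Kontsevich–Zagier period lies in
the additive subgroup of `ℝ` generated by the volumes of bounded `ℚ`-semialgebraic sets
(Yoshinaga 2008, Lemma 24: "`𝒫` is generated by `{vol(D) | D ⊂ ℝ^k` bounded basic open
semi-algebraic set`}`", proved there from Hironaka's rectilinearization theorem and
Belkale–Brosnan's description of periods), then every real period is an elementary real number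
(Thm. 18) — by `Yoshinaga.isElementaryReal_volume_of_isSemialgebraic_of_isBounded` (§3.4–3.6)
and the additive closure of the elementary reals (`IsElementaryReal.of_mem_addSubgroupClosure`,
Prop. 10). [cite: Yoshinaga2008, Theorem 18] -/
theorem isElementaryReal_of_isRealPeriod_of_lemma24
    (h : ∀ x : ℝ, IsRealPeriod x →
      x ∈ AddSubgroup.closure {v : ℝ | ∃ (m : ℕ) (D : Set (Fin m → ℝ)),
        IsSemialgebraic ℚ D ∧ Bornology.IsBounded D ∧ v = (volume D).toReal}) :
    isElementaryReal_of_isRealPeriod := by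
  intro x hx
  refine IsElementaryReal.of_mem_addSubgroupClosure ?_ (h x hx)
  rintro v ⟨m, D, hD, hb, rfl⟩
  exact Yoshinaga.isElementaryReal_volume_of_isSemialgebraic_of_isBounded hD hb

/-- **Yoshinaga's theorem from his Lemma 24, ring form.** The same reduction with "generated"
read as *ring* generation: if every real period lies in the subring of `ℝ` generated by the
volumes of bounded `ℚ`-semialgebraic sets, then every real period is an elementary real
(using that the elementary reals form a subring, `IsElementaryReal.of_mem_subringClosure`,
Prop. 10). [cite: Yoshinaga2008, Theorem 18] -/
theorem isElementaryReal_of_isRealPeriod_of_lemma24'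
    (h : ∀ x : ℝ, IsRealPeriod x →
      x ∈ Subring.closure {v : ℝ | ∃ (m : ℕ) (D : Set (Fin m → ℝ)),
        IsSemialgebraic ℚ D ∧ Bornology.IsBounded D ∧ v = (volume D).toReal}) :
    isElementaryReal_of_isRealPeriod := by
  intro x hx
  refine IsElementaryReal.of_mem_subringClosure ?_ (h x hx)
  rintro v ⟨m, D, hD, hb, rfl⟩
  exact Yoshinaga.isElementaryReal_volume_of_isSemialgebraic_of_isBounded hD hb

/-! ### The bounded-reduction and bounded-representation forms -/

/-- **Yoshinaga's theorem from the bounded reduction of periods** (Viu-Sos 2021, Cor. 2.3 /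
Yoshinaga 2008, Lemma 24, taken as a hypothesis as in
`isComputableReal_of_isRealPeriod_of_boundedReduction`): if every real period is
`vol(K₁) - vol(K₂)` with `K₁, K₂` bounded `ℚ`-semialgebraic, then every real period is an
elementary real. [cite: Yoshinaga2008, Theorem 18] -/
theorem isElementaryReal_of_isRealPeriod_of_boundedReduction
    (H : ∀ x : ℝ, IsRealPeriod x → ∃ (d : ℕ) (K₁ K₂ : Set (Fin d → ℝ)),
      IsSemialgebraic ℚ K₁ ∧ IsSemialgebraic ℚ K₂ ∧ Bornology.IsBounded K₁ ∧ Bornology.IsBounded K₂ ∧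
        x = (volume K₁).toReal - (volume K₂).toReal) :
    isElementaryReal_of_isRealPeriod := by
  intro x hx
  obtain ⟨d, K₁, K₂, h₁, h₂, hb₁, hb₂, rfl⟩ := H x hx
  exact (Yoshinaga.isElementaryReal_volume_of_isSemialgebraic_of_isBounded h₁ hb₁).sub
    (Yoshinaga.isElementaryReal_volume_of_isSemialgebraic_of_isBounded h₂ hb₂)

namespace KZ.IntegralRep

variable {n : ℕ}

/-- **An integral representation with bounded data is a difference of two bounded semialgebraic
volumes**: `r.value = vol(E₊) - vol(E₋)` for the strict subgraphs
`E_± = {(x, t) | x ∈ σ, 0 < t < ±f x} ⊆ ℝⁿ⁺¹`, which are `ℚ`-semialgebraic (graph elimination,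
Tarski–Seidenberg) and bounded when `σ` and `f|σ` are (the passage `∫_{K_α} H = vol(D_α)` of
Yoshinaga 2008, proof of Lemma 24 (i); the argument of
`KZ.IntegralRep.isComputableReal_value_of_bounded`, recorded as a decomposition).
[cite: Yoshinaga2008, Lemma 24 (i)] -/
theorem exists_value_eq_volume_sub_of_bounded (r : IntegralRep n)
    (hb : Bornology.IsBounded r.domain) (hM : ∃ M : ℝ, ∀ x ∈ r.domain, |r.integrand x| ≤ M) :
    ∃ E₁ E₂ : Set (Fin (n + 1) → ℝ), IsSemialgebraic ℚ E₁ ∧ IsSemialgebraic ℚ E₂ ∧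
      Bornology.IsBounded E₁ ∧ Bornology.IsBounded E₂ ∧
        r.value = (volume E₁).toReal - (volume E₂).toReal := by
  obtain ⟨M, hM⟩ := hM
  have hTS : Literature.ModelTheory.ExponentialFields.tarski_seidenberg_real (k := ℚ) :=
    Literature.ModelTheory.ExponentialFields.tarski_seidenberg_real_holds
  have hσm : MeasurableSet r.domain := IntegralRep.measurableSet_domain_holds r
  set E : ((Fin n → ℝ) → ℝ) → Set (Fin (n + 1) → ℝ) := fun g =>
    {v | Fin.init v ∈ r.domain ∧ 0 < v (Fin.last n) ∧ v (Fin.last n) < g (Fin.init v)} with hE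
  have hT : IsSemialgebraic ℚ {u : Fin (n + 2) → ℝ |
      0 < u (Fin.castSucc (Fin.last n)) ∧ u (Fin.castSucc (Fin.last n)) < u (Fin.last (n + 1))} := by
    have h1 := isSemialgebraic_setOf_eval_pos (k := ℚ) (R := ℝ)
      (MvPolynomial.X (Fin.castSucc (Fin.last n)) : MvPolynomial (Fin (n + 2)) ℚ)
    have h2 := isSemialgebraic_setOf_eval_lt (k := ℚ) (R := ℝ)
      (MvPolynomial.X (Fin.castSucc (Fin.last n)) : MvPolynomial (Fin (n + 2)) ℚ)
      (MvPolynomial.X (Fin.last (n + 1)))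
    convert h1.inter h2 using 1
    ext u
    simp [Set.mem_inter_iff]
  have hEsa : ∀ g, IsSemialgebraicFunOn ℚ r.domain g → IsSemialgebraic ℚ (E g) := by
    intro g hg
    convert hg.isSemialgebraic_setOf_snoc_mem hTS hT using 1
    ext v
    simp [hE]
  have hEb : ∀ g, (∀ x ∈ r.domain, |g x| ≤ M) → Bornology.IsBounded (E g) := by
    intro g hgM
    obtain ⟨ρ, hρ⟩ := hb.subset_closedBall 0
    rw [isBounded_iff_forall_norm_le]
    refine ⟨max ρ M, fun v hv => ?_⟩
    obtain ⟨hv1, hv2, hv3⟩ := hv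
    have hinit : ‖Fin.init v‖ ≤ ρ := by simpa using hρ hv1
    rw [pi_norm_le_iff_of_nonneg ((norm_nonneg _).trans hinit |>.trans (le_max_left _ _))]
    intro i
    refine Fin.lastCases ?_ (fun j => ?_) i
    · rw [Real.norm_eq_abs, abs_of_pos hv2]
      exact ((hv3.le.trans (le_abs_self _)).trans (hgM _ hv1)).trans (le_max_right _ _)
    · have : ‖Fin.init v j‖ ≤ ‖Fin.init v‖ := norm_le_pi_norm _ j
      exact (this.trans hinit).trans (le_max_left _ _)
  have hEvol : ∀ g, IsSemialgebraicFunOn ℚ r.domain g → IntegrableOn g r.domain →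
      (volume (E g)).toReal = ∫ x in r.domain, max (g x) 0 := by
    intro g hg hgi
    rw [hE]
    dsimp only
    rw [volume_subgraph_eq hσm (hg.measurable_indicator_of_tarskiSeidenberg hTS hσm) hgi,
      ENNReal.toReal_ofReal]
    exact setIntegral_nonneg hσm fun x _ => le_max_right _ _
  have hf := r.isSemialgebraicFunOn_integrand
  have hfi := r.integrableOn
  refine ⟨E r.integrand, E (-r.integrand), hEsa _ hf, hEsa _ hf.neg, hEb _ hM,
    hEb _ (fun x hx => by simpa using hM x hx), ?_⟩
  rw [hEvol _ hf hfi, hEvol _ hf.neg hfi.neg]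
  simp only [Pi.neg_apply]
  rw [← integral_sub hfi.pos_part hfi.neg_part, value]
  refine integral_congr_ae (Filter.Eventually.of_forall fun x => ?_)
  exact (max_zero_sub_max_neg_zero_eq_self (r.integrand x)).symm

/-- **Integral representations with bounded data represent elementary reals**: by
`exists_value_eq_volume_sub_of_bounded` and
`Yoshinaga.isElementaryReal_volume_of_isSemialgebraic_of_isBounded` (Yoshinaga 2008, Lemma 24 (i)
followed by §3.3–3.6). [cite: Yoshinaga2008, Lemma 24 (i) and §3.6] -/
theorem isElementaryReal_value_of_bounded (r : IntegralRep n) (hb : Bornology.IsBounded r.domain)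
    (hM : ∃ M : ℝ, ∀ x ∈ r.domain, |r.integrand x| ≤ M) : IsElementaryReal r.value := by
  obtain ⟨E₁, E₂, h₁, h₂, hb₁, hb₂, hval⟩ := r.exists_value_eq_volume_sub_of_bounded hb hM
  rw [hval]
  exact (Yoshinaga.isElementaryReal_volume_of_isSemialgebraic_of_isBounded h₁ hb₁).sub
    (Yoshinaga.isElementaryReal_volume_of_isSemialgebraic_of_isBounded h₂ hb₂)

end KZ.IntegralRep

/-- **Yoshinaga's theorem from bounded representations** (Thm. 18 with Lemma 24 (i), taken as a
hypothesis as in `isComputableReal_of_isRealPeriod_of_boundedRepresentation`): if every real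
period is the value of an integral representation with bounded domain and bounded integrand,
then every real period is an elementary real. [cite: Yoshinaga2008, Theorem 18] -/
theorem isElementaryReal_of_isRealPeriod_of_boundedRepresentation
    (H : ∀ x : ℝ, IsRealPeriod x → ∃ (n : ℕ) (r : KZ.IntegralRep n), Bornology.IsBounded r.domain ∧
      (∃ M : ℝ, ∀ y ∈ r.domain, |r.integrand y| ≤ M) ∧ r.value = x) :
    isElementaryReal_of_isRealPeriod := by
  intro x hx
  obtain ⟨n, r, hb, hM, rfl⟩ := H x hx
  exact r.isElementaryReal_value_of_bounded hb hM

end Literature.NumberTheory.Transcendental
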